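import Mathlib
import HarnessLib
import Literature.Computability.AlgebraicComplexity.StrassenSpectralTheorem
import Literature.Computability.AlgebraicComplexity.TensorSemiringSpectrum
import Literature.Computability.AlgebraicComplexity.KroneckerRank
import Literature.Computability.AlgebraicComplexity.TensorRestrictionRank
import Literature.Computability.AlgebraicComplexity.BorderRankCW
import Literature.Computability.AlgebraicComplexity.MatrixMultiplicationExponent
import Summits.MatrixMultiplication.MatrixMultiplication.Theorems.OutsiderSandwichDegenerationWitnessRestrictions

/-!
# OutsiderSandwich — spectral TRANSFER: from `∀ F ∈ Δ(ℂ), F(s) ≤ F(cw₂)^N` to actual restrictions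
# `s^{⊠n} ≤ cw₂^{⊠(N n + o(n))}` (decomp-mm lens-4, gen 13, part 1/2; ROUTE-INDEPENDENT core)

Lens «minimal counterexample / extremal reduction».  Generations 11–12 put the cut of record
`ω = 2 ⟺ LaserTangency ∧ LaserMergeOptimal` against Strassen's asymptotic spectrum in the EASY
direction only (apply a spectral point `F` to a restriction).  This file packages the HARD direction
of **Strassen's spectral theorem** (tree: `IsStrassenPreorder.asympLe_of_forall_spectralPoint`,
Zuiddam 2018 Thm. 2.12, on the Strassen-preordered semiring `T(ℂ) = TensorClass ℂ`,
`TensorClass.isStrassenPreorder`) in the concrete form the route's statements consume: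

* `asympLe_of_forall_universal` — if every universal spectral point has `F s ≤ F t` then
  `[s] ≲ [t]`: `[s]^n ≤ f(n) · [t]^n` with `f` subexponential (spectral points of `(T(ℂ), ≤)` ARE the
  universal spectral points: `TensorClass.isUniversalSpectralPoint_spectralMapOf`);
* `two_le_cwClass` — **`cw₂ ≥ ⟨2⟩`** (tree: `cwTwo_restrictsTo_unitTwo`), hence `⟨f⟩ ≤ cw₂^{⊠r}` whenever `f ≤ 2^r` (`natCast_le_cwClass_pow`): the
  subexponential factor of `≲` is ABSORBED into `o(n)` extra tensor factors of `cw₂`;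
* `exists_cwClass_pow_of_spectral_le` — the transfer theorem: `∀ F, F s ≤ F(cw₂)^N` gives
  `r : ℕ → ℕ` with `2^{r(n)}` subexponential and `[s]^n ≤ [cw₂]^{N n + r(n)}` for every `n`;
* class identities for the consumers: `mk_matMul_mul`, `mk_matMul_pow` (`[⟨a,a,a⟩]^n = [⟨aⁿ,aⁿ,aⁿ⟩]`),
  `map_unitTensor`, `map_packing` (`F(⟨B⟩ ⊗ ⟨a,a,a⟩) = B·F⟨a,a,a⟩`), `exists_le_self_of_isSubexponential`
  (`2^{r(n)}` subexponential ⟹ `r(n) ≤ n` for some `n ≥ 1`), and the unpacked forms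
  `restrictsTo_matMul_of_spectral_le`, `restrictsTo_packing_of_spectral_le`
  (`cw₂^{⊠(N n + r n)} ≥ ⟨2^{β n}⟩ ⊗ ⟨2^{k n}, 2^{k n}, 2^{k n}⟩`).

No route file is imported (critic g12 §5: lens-4 Theorems should sit on a route-independent core);
part 2 (`OutsiderSandwichSpectralConverse`) applies this to the route items.  All sorry-free.

Sources: Strassen1988 (Thm. 2.4), Zuiddam2018 (Lemma 2.11, Thm. 2.12, §2.3 «tensors»),
ChristandlVranaZuiddam2023 (§1.2, universal spectral points), Blaser2013 (§5.2, §7),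
CoppersmithWinograd1990 (§6, the tensor `cw₂`).
-/

set_option linter.dupNamespace false

namespace Summit.MatrixMultiplication.MatrixMultiplication.Theorems.OutsiderSandwichSpectralTransfer

open scoped BigOperators
open Literature.Computability.AlgebraicComplexity
open Literature.Computability.AlgebraicComplexity.TensorClass

noncomputable section

/-! ## 1. The hard direction of Strassen's spectral theorem, universal-point form -/

/-- **Strassen transfer.**  If every universal spectral point `F ∈ Δ(ℂ)` has `F s ≤ F t`, then
`[s] ≲ [t]` in `T(ℂ)`: there is a subexponential `f` with `[s]^n ≤ f(n)·[t]^n` for all `n`.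
(Zuiddam Thm. 2.12 on `(T(ℂ), ≤)`; its spectral points are the universal spectral points.) -/
theorem asympLe_of_forall_universal {ι κ μ ι' κ' μ' : Type} [Fintype ι] [Fintype κ] [Fintype μ]
    [Fintype ι'] [Fintype κ'] [Fintype μ'] {s : ι → κ → μ → ℂ} {t : ι' → κ' → μ' → ℂ}
    (h : ∀ F : SpectralMap ℂ, IsUniversalSpectralPoint ℂ F → F s ≤ F t) :
    ∃ f : ℕ → ℕ, IsSubexponential f ∧
      ∀ n : ℕ, (TensorClass.mk s) ^ n ≤ (f n : TensorClass ℂ) * (TensorClass.mk t) ^ n := by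
  have H := (TensorClass.isStrassenPreorder ℂ).asympLe_of_forall_spectralPoint
    (TensorClass.mk s) (TensorClass.mk t) (fun φ hφ => by
      have hF := TensorClass.isUniversalSpectralPoint_spectralMapOf hφ
      have := h _ hF
      rwa [TensorClass.spectralMapOf_apply, TensorClass.spectralMapOf_apply] at this)
  obtain ⟨f, hf, hle⟩ := H
  exact ⟨f, hf, fun n => hle n⟩

/-! ## 2. `cw₂ ≥ ⟨2⟩` and absorption of the subexponential factor -/

/-- `2 ≤ [cw₂]` in `T(ℂ)`. -/
theorem two_le_cwClass : ((2 : ℕ) : TensorClass ℂ) ≤ TensorClass.mk (cwTensor ℂ 2) := by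
  rw [TensorClass.natCast_eq_mk, TensorClass.mk_le_mk_iff]
  exact OutsiderSandwichDegenerationWitness.cwTwo_restrictsTo_unitTwo

/-- `2^r ≤ [cw₂]^r`. -/
theorem two_pow_le_cwClass_pow (r : ℕ) :
    ((2 ^ r : ℕ) : TensorClass ℂ) ≤ TensorClass.mk (cwTensor ℂ 2) ^ r := by
  induction r with
  | zero => simp
  | succ r ih =>
    rw [pow_succ, pow_succ, Nat.cast_mul]
    exact TensorClass.mul_le_mul ih two_le_cwClass

/-- **Absorption**: `⟨f⟩ ≤ cw₂^{⊠r}` whenever `f ≤ 2^r`. -/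
theorem natCast_le_cwClass_pow {f r : ℕ} (h : f ≤ 2 ^ r) :
    (f : TensorClass ℂ) ≤ TensorClass.mk (cwTensor ℂ 2) ^ r :=
  le_trans (TensorClass.natCast_le_natCast_iff.2 h) (two_pow_le_cwClass_pow r)

/-- `2^{⌈log₂ f⌉} ≤ 2 f + 2`. -/
theorem two_pow_clog_le (f : ℕ) : 2 ^ Nat.clog 2 f ≤ 2 * f + 2 := by
  rcases Nat.lt_or_ge f 2 with hf | hf
  · interval_cases f <;> simp
  · have hpos : 0 < Nat.clog 2 f := Nat.clog_pos one_lt_two (by omega)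
    obtain ⟨c, hc⟩ : ∃ c, Nat.clog 2 f = c + 1 := Nat.exists_eq_succ_of_ne_zero hpos.ne'
    have h1 := Nat.pow_pred_clog_lt_self one_lt_two (x := f) (by omega)
    rw [hc, Nat.pred_succ] at h1
    rw [hc, pow_succ]
    generalize 2 ^ c = P at h1 ⊢
    omega

/-- `f + c` and `a f + c` stay subexponential. -/
theorem isSubexponential_affine {f : ℕ → ℕ} (hf : IsSubexponential f) (a c : ℕ) :
    IsSubexponential fun n => a * f n + c := by
  intro ε hε
  obtain ⟨C, hC⟩ := hf ε hε
  refine ⟨a * C + c, fun n => ?_⟩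
  have h1 : (1 : ℝ) ≤ (1 + ε) ^ n := one_le_pow₀ (by linarith)
  have hC0 : 0 ≤ C := by
    have := hC 0
    simp at this
    exact (Nat.cast_nonneg _).trans this
  push_cast
  nlinarith [hC n, Nat.cast_nonneg (α := ℝ) a, Nat.cast_nonneg (α := ℝ) c,
    mul_nonneg (Nat.cast_nonneg (α := ℝ) a) hC0]

/-- If `2^{r(n)}` is subexponential then `r(n) ≤ n` for some `n ≥ 1` (indeed for all large `n`). -/
theorem exists_le_self_of_isSubexponential {r : ℕ → ℕ} (hr : IsSubexponential fun n => 2 ^ r n) :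
    ∃ n : ℕ, 1 ≤ n ∧ r n ≤ n := by
  obtain ⟨C, hC⟩ := hr (1 / 2) (by norm_num)
  have hlim := tendsto_pow_atTop_atTop_of_one_lt (show (1 : ℝ) < 4 / 3 by norm_num)
  obtain ⟨n, hn, hn1⟩ := ((hlim.eventually_ge_atTop C).and (Filter.eventually_ge_atTop 1)).exists
  refine ⟨n, hn1, ?_⟩
  have h1 : ((2 ^ r n : ℕ) : ℝ) ≤ C * (1 + 1 / 2) ^ n := hC n
  have h2 : C * (1 + 1 / 2) ^ n ≤ (4 / 3 : ℝ) ^ n * (1 + 1 / 2) ^ n :=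
    mul_le_mul_of_nonneg_right hn (by positivity)
  have h3 : (4 / 3 : ℝ) ^ n * (1 + 1 / 2) ^ n = 2 ^ n := by
    rw [← mul_pow]; norm_num
  have h4 : ((2 ^ r n : ℕ) : ℝ) ≤ ((2 ^ n : ℕ) : ℝ) := by
    push_cast
    have := h1.trans h2
    rw [h3] at this
    exact_mod_cast this
  exact (Nat.pow_le_pow_iff_right (show 1 < 2 by norm_num)).1 (by exact_mod_cast h4)

/-! ## 3. The transfer theorem onto powers of `cw₂` -/

/-- **Transfer onto `cw₂`-powers.**  If `F s ≤ F(cw₂)^N` for every universal spectral point `F`, then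
for some `r : ℕ → ℕ` with `2^{r(n)}` subexponential, `[s]^n ≤ [cw₂]^{N n + r(n)}` for every `n`. -/
theorem exists_cwClass_pow_of_spectral_le {ι κ μ : Type} [Fintype ι] [Fintype κ] [Fintype μ]
    {s : ι → κ → μ → ℂ} (N : ℕ)
    (h : ∀ F : SpectralMap ℂ, IsUniversalSpectralPoint ℂ F → F s ≤ F (cwTensor ℂ 2) ^ N) :
    ∃ r : ℕ → ℕ, IsSubexponential (fun n => 2 ^ r n) ∧
      ∀ n : ℕ, (TensorClass.mk s) ^ n ≤ TensorClass.mk (cwTensor ℂ 2) ^ (N * n + r n) := by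
  have h' : ∀ F : SpectralMap ℂ, IsUniversalSpectralPoint ℂ F →
      F s ≤ F (kroneckerPow (cwTensor ℂ 2) N) := by
    intro F hF
    have e : F (kroneckerPow (cwTensor ℂ 2) N) = F (cwTensor ℂ 2) ^ N := by
      rw [← TensorClass.evalRingHom_mk hF, ← TensorClass.mk_pow, map_pow, TensorClass.evalRingHom_mk]
    rw [e]; exact h F hF
  obtain ⟨f, hf, hle⟩ := asympLe_of_forall_universal h'
  refine ⟨fun n => Nat.clog 2 (f n), ?_, fun n => ?_⟩
  · exact (isSubexponential_affine hf 2 2).of_le (fun n => two_pow_clog_le (f n))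
  · have h1 := hle n
    rw [← TensorClass.mk_pow, ← pow_mul] at h1
    calc (TensorClass.mk s) ^ n
        ≤ (f n : TensorClass ℂ) * TensorClass.mk (cwTensor ℂ 2) ^ (N * n) := h1
      _ ≤ TensorClass.mk (cwTensor ℂ 2) ^ (Nat.clog 2 (f n)) *
            TensorClass.mk (cwTensor ℂ 2) ^ (N * n) :=
          TensorClass.mul_le_mul (natCast_le_cwClass_pow (Nat.le_pow_clog one_lt_two _)) le_rfl
      _ = TensorClass.mk (cwTensor ℂ 2) ^ (N * n + Nat.clog 2 (f n)) := by
          rw [← pow_add, Nat.add_comm (Nat.clog 2 (f n)) (N * n)]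

/-! ## 4. Class identities for matrix multiplication tensors and values of spectral points -/

/-- `[⟨a,a,a⟩]·[⟨m,m,m⟩] = [⟨am,am,am⟩]` (double-index relabelling). -/
theorem mk_matMul_mul (a m : ℕ) :
    TensorClass.mk (matMulTensor ℂ a a a) * TensorClass.mk (matMulTensor ℂ m m m) =
      TensorClass.mk (matMulTensor ℂ (a * m) (a * m) (a * m)) := by
  classical
  rw [TensorClass.mk_mul_mk]
  have e : kroneckerTensor (matMulTensor ℂ a a a) (matMulTensor ℂ m m m) =
      fun x y z => matMulTensor ℂ (a * m) (a * m) (a * m)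
        (doubleIndexEquiv a a m m x) (doubleIndexEquiv a a m m y) (doubleIndexEquiv a a m m z) := by
    funext x y z
    exact kroneckerTensor_matMulTensor (K := ℂ) a a a m m m x y z
  rw [e]
  exact TensorClass.mk_reindex (matMulTensor ℂ (a * m) (a * m) (a * m)) _ _ _

/-- `[⟨a,a,a⟩]^n = [⟨aⁿ,aⁿ,aⁿ⟩]`. -/
theorem mk_matMul_pow (a n : ℕ) :
    TensorClass.mk (matMulTensor ℂ a a a) ^ n =
      TensorClass.mk (matMulTensor ℂ (a ^ n) (a ^ n) (a ^ n)) := by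
  induction n with
  | zero =>
    rw [pow_zero, pow_zero]
    -- `[⟨1,1,1⟩] = 1 = [⟨1⟩]`
    rw [TensorClass.one_def]
    classical
    have e : matMulTensor ℂ 1 1 1 = fun x y z => unitTensor ℂ 1
        ((Equiv.prodUnique (Fin 1) (Fin 1)) x) ((Equiv.prodUnique (Fin 1) (Fin 1)) y)
        ((Equiv.prodUnique (Fin 1) (Fin 1)) z) := by
      funext x y z
      obtain rfl : x = (0, 0) := Subsingleton.elim _ _
      obtain rfl : y = (0, 0) := Subsingleton.elim _ _
      obtain rfl : z = (0, 0) := Subsingleton.elim _ _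
      simp [matMulTensor, unitTensor]
    rw [e]
    exact (TensorClass.mk_reindex (unitTensor ℂ 1) _ _ _).symm
  | succ n ih => rw [pow_succ, ih, mk_matMul_mul, ← pow_succ]

variable {F : SpectralMap ℂ}

/-- `F(⟨n⟩) = n`. -/
theorem map_unitTensor (hF : IsUniversalSpectralPoint ℂ F) (n : ℕ) : F (unitTensor ℂ n) = n := by
  rw [← TensorClass.evalRingHom_mk hF, ← TensorClass.natCast_eq_mk, map_natCast]

/-- `F(⟨B⟩ ⊗ ⟨a,a,a⟩) = B · F(⟨a,a,a⟩)`. -/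
theorem map_packing (hF : IsUniversalSpectralPoint ℂ F) (B a : ℕ) :
    F (kroneckerTensor (unitTensor ℂ B) (matMulTensor ℂ a a a)) = B * F (matMulTensor ℂ a a a) := by
  rw [hF.map_kronecker, map_unitTensor hF]

/-! ## 5. Unpacked transfer statements (the shapes of the route's items) -/

/-- **Single products.**  If `F(⟨2^k,2^k,2^k⟩) ≤ F(cw₂)^N` for all universal `F`, then for some `r` with
`2^{r(n)}` subexponential, `cw₂^{⊠(N n + r n)} ≥ ⟨2^{kn}, 2^{kn}, 2^{kn}⟩` for every `n`. -/
theorem restrictsTo_matMul_of_spectral_le (k N : ℕ)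
    (h : ∀ F : SpectralMap ℂ, IsUniversalSpectralPoint ℂ F →
      F (matMulTensor ℂ (2 ^ k) (2 ^ k) (2 ^ k)) ≤ F (cwTensor ℂ 2) ^ N) :
    ∃ r : ℕ → ℕ, IsSubexponential (fun n => 2 ^ r n) ∧ ∀ n : ℕ,
      TensorRestrictsTo (kroneckerPow (cwTensor ℂ 2) (N * n + r n))
        (matMulTensor ℂ (2 ^ (k * n)) (2 ^ (k * n)) (2 ^ (k * n))) := by
  obtain ⟨r, hr, hle⟩ := exists_cwClass_pow_of_spectral_le N h
  refine ⟨r, hr, fun n => ?_⟩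
  have h1 := hle n
  have e : (TensorClass.mk (matMulTensor ℂ (2 ^ k) (2 ^ k) (2 ^ k))) ^ n =
      TensorClass.mk (matMulTensor ℂ (2 ^ (k * n)) (2 ^ (k * n)) (2 ^ (k * n))) := by
    rw [pow_mul]; exact mk_matMul_pow (2 ^ k) n
  rw [e, TensorClass.mk_pow, TensorClass.mk_le_mk_iff] at h1
  exact h1

/-- **Packings.**  If `F(⟨2^β⟩ ⊗ ⟨2^k,2^k,2^k⟩) ≤ F(cw₂)^N` for all universal `F`, then for some `r`
with `2^{r(n)}` subexponential, `cw₂^{⊠(N n + r n)} ≥ ⟨2^{βn}⟩ ⊗ ⟨2^{kn}, 2^{kn}, 2^{kn}⟩` for every `n`. -/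
theorem restrictsTo_packing_of_spectral_le (β k N : ℕ)
    (h : ∀ F : SpectralMap ℂ, IsUniversalSpectralPoint ℂ F →
      F (kroneckerTensor (unitTensor ℂ (2 ^ β)) (matMulTensor ℂ (2 ^ k) (2 ^ k) (2 ^ k))) ≤
        F (cwTensor ℂ 2) ^ N) :
    ∃ r : ℕ → ℕ, IsSubexponential (fun n => 2 ^ r n) ∧ ∀ n : ℕ,
      TensorRestrictsTo (kroneckerPow (cwTensor ℂ 2) (N * n + r n))
        (kroneckerTensor (unitTensor ℂ (2 ^ (β * n)))
          (matMulTensor ℂ (2 ^ (k * n)) (2 ^ (k * n)) (2 ^ (k * n)))) := by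
  obtain ⟨r, hr, hle⟩ := exists_cwClass_pow_of_spectral_le N h
  refine ⟨r, hr, fun n => ?_⟩
  have h1 := hle n
  have e : (TensorClass.mk (kroneckerTensor (unitTensor ℂ (2 ^ β))
      (matMulTensor ℂ (2 ^ k) (2 ^ k) (2 ^ k)))) ^ n =
      TensorClass.mk (kroneckerTensor (unitTensor ℂ (2 ^ (β * n)))
        (matMulTensor ℂ (2 ^ (k * n)) (2 ^ (k * n)) (2 ^ (k * n)))) := by
    rw [← TensorClass.mk_mul_mk, ← TensorClass.mk_mul_mk, ← TensorClass.natCast_eq_mk,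
      ← TensorClass.natCast_eq_mk, mul_pow, ← Nat.cast_pow, ← pow_mul, pow_mul (2 : ℕ) k n]
    have := mk_matMul_pow (2 ^ k) n
    rw [this]
  rw [e, TensorClass.mk_pow, TensorClass.mk_le_mk_iff] at h1
  exact h1

/-! ## 6. Two numeric helpers used by the converses -/

/-- `log₂ 3 < 2`, hence `b_L = log₂3 − 2/3 < 4/3`. -/
theorem logb_two_three_sub_lt : Real.logb 2 3 - 2 / 3 < 4 / 3 := by
  have : Real.logb 2 3 < 2 := by
    rw [Real.logb_lt_iff_lt_rpow one_lt_two (by norm_num : (0 : ℝ) < 3), Real.rpow_two]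
    norm_num
  linarith

/-- Archimedes: a level `N ≥ N₀`, `N ≥ 1` with `c ≤ κ N`. -/
theorem exists_level (N₀ : ℕ) {κ : ℝ} (hκ : 0 < κ) (c : ℝ) :
    ∃ N : ℕ, N₀ ≤ N ∧ 1 ≤ N ∧ c ≤ κ * N := by
  obtain ⟨M, hM⟩ := exists_nat_ge (c / κ)
  refine ⟨max N₀ (max 1 M), le_max_left _ _, le_trans (le_max_left 1 M) (le_max_right _ _), ?_⟩
  have h1 : (M : ℝ) ≤ ((max N₀ (max 1 M) : ℕ) : ℝ) := by
    exact_mod_cast le_trans (le_max_right 1 M) (le_max_right _ _)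
  have h2 : c ≤ κ * M := by
    have := (div_le_iff₀ hκ).1 hM
    linarith
  exact h2.trans (mul_le_mul_of_nonneg_left h1 hκ.le)

end

end Summit.MatrixMultiplication.MatrixMultiplication.Theorems.OutsiderSandwichSpectralTransfer
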